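import Summits.CriticalPhenomena.SAWScalingLimit.Theorems.ObservableToSLER.Negative.RootRenewalDefects
import Summits.CriticalPhenomena.SAWScalingLimit.Theorems.BoundaryClosureNegative_Walks

/-!
# Crux `ObservableToSLER` (stmt-CriticalPhenomena-14005): `RootRenewal` is false — part 1, the forcing domain (definition, connected complement, patch and far clauses)

Negative lemma (refuter, cdisprove cycle 2), completing `Negative.RootRenewalDefects`: the sketch
`Cruxes/ObservableToSLER/RootRenewalSketch.lean` of crux idea `root-renewal-kesten` types its
load-bearing input as `RootRenewal` (RR; its statement is written out verbatim, inline, as the negated proposition of `not_rootRenewal` — no named copy, so that no false proposition is filed as a fact).  We realise the forcing domain of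
`RootRenewalDefects` §(b) for ARBITRARY `K` and `R₀` and conclude **`not_rootRenewal : ¬ RootRenewal`**.

The forcing domain `Λ_{K,N}` (`N := ⌈R₀⌉₊`), in the face coordinates `fj j r` of the landed lattice
engine `BoundaryClosureNegative_Lattice` (row `r`, row-order index `j`, abscissa `(j + r + 1)/2`):
* a SLANTED BOX `{0 ≤ r ≤ H − 1, −4N − 2 ≤ j ≤ 2N + 2}` — it contains every face of nonnegative row
  within distance `R₀` of the source face `w = fj 0 1` (`patch_clause`: `|Δre|, |Δim| ≤ dist`,
  `√3 > 17/10`), so RR's exact half-ball patch clause holds, while RR leaves the geometry beyond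
  the ball free;
* the TOP ROW `r = H := 2^K + 2N + 4` over `−4N − 2 ≤ j ≤ jD + 1`;
* the SLANTED DOUBLE COLUMN `{jD, jD + 1} × {0 … H}`, `jD := 2N + 6`, separated from the box by the
  free columns `2N + 3 ≤ j ≤ 2N + 5`;
* source mid-edge `s(fj 1 1, fj 0 1)`, target mid-edge `z = s(fj jD 0, fj (jD+1) (−1))` (its outer
  face has row `−1`, outside `Λ`; both faces at abscissa distance `N + 5/2 ≥ R₀` from `w`,
  `far_clause`).
Checked here: `simplyConnected_Lam` (every complement face escapes to row `−1` by a row walk and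
a slanted column: negative rows, far right, far left, the free gap columns, above the top row),
`patch_clause`, `far_clause`, and the mid-edge facts; part 2 (`NotRootRenewal`) proves `forcedU`,
`nonempty_saw` and `not_rootRenewal`. [folklore]
-/

noncomputable section

open Literature.Probability.RandomPlanarGeometry Literature.Probability.RandomPlanarGeometry.SAW
  Literature.Probability.LatticeModels
open scoped Classical

namespace Summit.CriticalPhenomena.SAWScalingLimit.Theorems.ObservableToSLER.Negative

namespace RootRenewalDefects

open Summit.CriticalPhenomena.SAWScalingLimit.Theorems.BoundaryClosure.Negative

/-! ### The forcing domain in `(j, r)` coordinates -/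

section Forcing

variable (K N : ℕ)

/-- Height of the top row: above the window top `2^K` and above the ball. [folklore] -/
def Ht : ℤ := 2 ^ K + 2 * N + 4

/-- Index of the (even) down column. [folklore] -/
def jD : ℤ := 2 * N + 6

/-- The slanted box: rows `0 … Ht-1`, indices `-4N-2 … 2N+2`. [folklore] -/
def InBox (j r : ℤ) : Prop := 0 ≤ r ∧ r ≤ Ht K N - 1 ∧ -(4 * N : ℤ) - 2 ≤ j ∧ j ≤ 2 * N + 2

/-- The top row `Ht`, indices `-4N-2 … jD+1`. [folklore] -/
def InTop (j r : ℤ) : Prop := r = Ht K N ∧ -(4 * N : ℤ) - 2 ≤ j ∧ j ≤ jD N + 1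

/-- The slanted double column `{jD, jD+1} × {0 … Ht}`. [folklore] -/
def InDown (j r : ℤ) : Prop := 0 ≤ r ∧ r ≤ Ht K N ∧ (j = jD N ∨ j = jD N + 1)

/-- Membership predicate of the forcing domain. [folklore] -/
def InLam (j r : ℤ) : Prop := InBox K N j r ∨ InTop K N j r ∨ InDown K N j r

/-- A bounding box for the coordinates. [folklore] -/
def Bnd : ℤ := 2 ^ K + 8 * N + 20

/-- The finite box of faces with coordinates in `[-Bnd, Bnd]²`. [folklore] -/
def bbox : Finset HexVertex :=
  ((Finset.Icc (-Bnd K N) (Bnd K N)) ×ˢ (Finset.Icc (-Bnd K N) (Bnd K N))).image fun p => fj p.1 p.2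

/-- **The forcing domain** `Λ_{K,N}`. [folklore] -/
def Lam : Finset HexVertex :=
  (bbox K N).filter fun v => InLam K N (jOf v) (rOf v)

variable {K N}

/-- The top row is above the window top. [folklore] -/
theorem Ht_ge : (2 : ℤ) ^ K + 4 ≤ Ht K N := by unfold Ht; omega

/-- `1 ≤ 2^K` in `ℤ`. [folklore] -/
theorem one_le_two_pow : (1 : ℤ) ≤ 2 ^ K := by exact_mod_cast Nat.one_le_two_pow

/-- Coordinates of faces of the forcing domain are bounded by `Bnd`. [folklore] -/
theorem InLam_bounds {j r : ℤ} (h : InLam K N j r) :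
    -Bnd K N ≤ j ∧ j ≤ Bnd K N ∧ -Bnd K N ≤ r ∧ r ≤ Bnd K N := by
  have := @one_le_two_pow K
  unfold InLam InBox InTop InDown Ht jD at h; unfold Bnd
  omega

/-- Membership of a coordinate face in `Λ`. [folklore] -/
theorem fj_mem_Lam_iff {j r : ℤ} : fj j r ∈ Lam K N ↔ InLam K N j r := by
  unfold Lam
  rw [Finset.mem_filter, jOf_fj, rOf_fj]
  constructor
  · exact fun h => h.2
  · intro h
    refine ⟨?_, h⟩
    obtain ⟨h1, h2, h3, h4⟩ := InLam_bounds h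
    unfold bbox
    rw [Finset.mem_image]
    exact ⟨(j, r), by simp [Finset.mem_Icc, h1, h2, h3, h4], rfl⟩

/-- Membership of a face in `Λ`, in coordinates. [folklore] -/
theorem mem_Lam_iff {v : HexVertex} : v ∈ Lam K N ↔ InLam K N (jOf v) (rOf v) := by
  rw [← fj_jOf_rOf v, fj_mem_Lam_iff, jOf_fj, rOf_fj]

/-- Membership of a coordinate face in the complement of `Λ`. [folklore] -/
theorem fj_mem_compl_iff {j r : ℤ} : fj j r ∈ (↑(Lam K N) : Set HexVertex)ᶜ ↔ ¬ InLam K N j r := by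
  rw [Set.mem_compl_iff, Finset.mem_coe, fj_mem_Lam_iff]

/-- All faces of `Λ` have nonnegative row. [folklore] -/
theorem row_nonneg_of_InLam {j r : ℤ} (h : InLam K N j r) : 0 ≤ r := by
  have := @one_le_two_pow K
  unfold InLam InBox InTop InDown Ht at h; omega

/-! ### The complement is connected: escape routes -/

/-- Faces of negative rows are in the complement. [folklore] -/
theorem compl_of_neg {j r : ℤ} (hr : r < 0) : fj j r ∈ (↑(Lam K N) : Set HexVertex)ᶜ :=
  fj_mem_compl_iff.2 fun h => absurd (row_nonneg_of_InLam h) (not_le.2 hr)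

/-- Faces far to the right (`j ≥ jD + 2`) are in the complement. [folklore] -/
theorem compl_of_right {j r : ℤ} (hj : jD N + 2 ≤ j) : fj j r ∈ (↑(Lam K N) : Set HexVertex)ᶜ := by
  rw [fj_mem_compl_iff]; unfold InLam InBox InTop InDown jD at *; omega

/-- Faces far to the left (`j ≤ -4N-3`) are in the complement. [folklore] -/
theorem compl_of_left {j r : ℤ} (hj : j ≤ -(4 * N : ℤ) - 3) : fj j r ∈ (↑(Lam K N) : Set HexVertex)ᶜ := by
  rw [fj_mem_compl_iff]; unfold InLam InBox InTop InDown jD at *; omega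

/-- Faces of the gap columns (`2N+3 ≤ j ≤ 2N+5`, rows `< Ht`) are in the complement. [folklore] -/
theorem compl_of_gap {j r : ℤ} (hj : 2 * N + 3 ≤ j) (hj' : j ≤ 2 * N + 5) (hr : r < Ht K N) :
    fj j r ∈ (↑(Lam K N) : Set HexVertex)ᶜ := by
  rw [fj_mem_compl_iff]; unfold InLam InBox InTop InDown jD at *; omega

/-- Faces above the top row are in the complement. [folklore] -/
theorem compl_of_high {j r : ℤ} (hr : Ht K N < r) : fj j r ∈ (↑(Lam K N) : Set HexVertex)ᶜ := by
  rw [fj_mem_compl_iff]; unfold InLam InBox InTop InDown at *; omega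

/-- The bottom row `-1` path to the base face `fj 0 (-1)`. [folklore] -/
theorem rch_bottom (j : ℤ) : (fj j (-1), fj 0 (-1)) ∈ RchRel (↑(Lam K N) : Set HexVertex)ᶜ :=
  rch_row_of_between (↑(Lam K N) : Set HexVertex)ᶜ (-1) j 0 fun i _ _ => compl_of_neg (by norm_num)

/-- From a complement face of a negative row to the base face. [folklore] -/
theorem rch_of_neg {j r : ℤ} (hr : r < 0) : (fj j r, fj 0 (-1)) ∈ RchRel (↑(Lam K N) : Set HexVertex)ᶜ := by
  obtain ⟨j₁, hj₁, h₁⟩ : ∃ j₁ : ℤ, j₁ % 2 = 1 ∧ (fj j r, fj j₁ r) ∈ RchRel (↑(Lam K N) : Set HexVertex)ᶜ := by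
    rcases Int.emod_two_eq_zero_or_one j with hj | hj
    · exact ⟨j + 1, by omega, rch_of_adj (compl_of_neg hr) (compl_of_neg hr) (adj_fj_succ j r)⟩
    · exact ⟨j, hj, rch_rfl (compl_of_neg hr)⟩
  obtain ⟨n, hn⟩ : ∃ n : ℕ, (n : ℤ) = -1 - r := ⟨(-1 - r).toNat, by omega⟩
  have step2 : (fj j₁ r, fj j₁ (r + n)) ∈ RchRel (↑(Lam K N) : Set HexVertex)ᶜ :=
    rch_col_up (↑(Lam K N) : Set HexVertex)ᶜ hj₁ r n (compl_of_neg hr) fun i _ hi =>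
      ⟨compl_of_neg (by omega), compl_of_neg (by omega)⟩
  rw [hn, show r + (-1 - r) = -1 by ring] at step2
  exact rch_trans (rch_trans h₁ step2) (rch_bottom j₁)

/-- Right escape: from a face whose whole right half-row is free, down to the base face. [folklore] -/
theorem rch_of_rightFree {j r : ℤ} (hr : 0 ≤ r) (hR : ∀ i, j ≤ i → fj i r ∈ (↑(Lam K N) : Set HexVertex)ᶜ) :
    (fj j r, fj 0 (-1)) ∈ RchRel (↑(Lam K N) : Set HexVertex)ᶜ := by
  set J : ℤ := 2 * (|j| + N + 4) with hJ
  have hjJ : j ≤ J := by have := le_abs_self j; have := abs_nonneg j; omega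
  have hJeven : J % 2 = 0 := by omega
  have hJfar : jD N + 2 ≤ J := by have := abs_nonneg j; unfold jD; omega
  have step1 : (fj j r, fj J r) ∈ RchRel (↑(Lam K N) : Set HexVertex)ᶜ := rch_row (↑(Lam K N) : Set HexVertex)ᶜ r j J hjJ fun i hi _ => hR i hi
  obtain ⟨n, hn⟩ : ∃ n : ℕ, (n : ℤ) = r + 1 := ⟨(r + 1).toNat, by omega⟩
  have step2 : (fj J r, fj J (r - n)) ∈ RchRel (↑(Lam K N) : Set HexVertex)ᶜ :=
    rch_col_down (↑(Lam K N) : Set HexVertex)ᶜ hJeven r n (hR J hjJ) fun i _ _ =>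
      ⟨compl_of_right hJfar, compl_of_right (by omega)⟩
  rw [hn, show r - (r + 1) = -1 by ring] at step2
  exact rch_trans (rch_trans step1 step2) (rch_bottom J)

/-- Left escape. [folklore] -/
theorem rch_of_leftFree {j r : ℤ} (hr : 0 ≤ r) (hL : ∀ i, i ≤ j → fj i r ∈ (↑(Lam K N) : Set HexVertex)ᶜ) :
    (fj j r, fj 0 (-1)) ∈ RchRel (↑(Lam K N) : Set HexVertex)ᶜ := by
  set J : ℤ := -(2 * (|j| + 4 * N + 4)) with hJ
  have hjJ : J ≤ j := by have := neg_abs_le j; have := abs_nonneg j; omega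
  have hJeven : J % 2 = 0 := by omega
  have hJfar : J + 1 ≤ -(4 * N : ℤ) - 3 := by have := abs_nonneg j; omega
  have step1 : (fj j r, fj J r) ∈ RchRel (↑(Lam K N) : Set HexVertex)ᶜ := rch_symm (rch_row (↑(Lam K N) : Set HexVertex)ᶜ r J j hjJ fun i _ hi => hL i hi)
  obtain ⟨n, hn⟩ : ∃ n : ℕ, (n : ℤ) = r + 1 := ⟨(r + 1).toNat, by omega⟩
  have step2 : (fj J r, fj J (r - n)) ∈ RchRel (↑(Lam K N) : Set HexVertex)ᶜ :=
    rch_col_down (↑(Lam K N) : Set HexVertex)ᶜ hJeven r n (hL J hjJ) fun i _ _ =>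
      ⟨compl_of_left (by omega), compl_of_left hJfar⟩
  rw [hn, show r - (r + 1) = -1 by ring] at step2
  exact rch_trans (rch_trans step1 step2) (rch_bottom J)

/-- Gap escape: from a face of the gap columns `2N+3 ≤ j ≤ 2N+5`, rows `0 … Ht-1`. [folklore] -/
theorem rch_of_gap {j r : ℤ} (hr : 0 ≤ r) (hr' : r < Ht K N) (hj : 2 * N + 3 ≤ j) (hj' : j ≤ 2 * N + 5) :
    (fj j r, fj 0 (-1)) ∈ RchRel (↑(Lam K N) : Set HexVertex)ᶜ := by
  -- move to the even face `J ∈ {2N+4}` of the same row inside the gap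
  set J : ℤ := 2 * N + 4 with hJ
  have hJeven : J % 2 = 0 := by omega
  have step1 : (fj j r, fj J r) ∈ RchRel (↑(Lam K N) : Set HexVertex)ᶜ :=
    rch_row_of_between (↑(Lam K N) : Set HexVertex)ᶜ r j J fun i hi hi' =>
      compl_of_gap (by omega) (by omega) hr'
  obtain ⟨n, hn⟩ : ∃ n : ℕ, (n : ℤ) = r + 1 := ⟨(r + 1).toNat, by omega⟩
  have step2 : (fj J r, fj J (r - n)) ∈ RchRel (↑(Lam K N) : Set HexVertex)ᶜ :=
    rch_col_down (↑(Lam K N) : Set HexVertex)ᶜ hJeven r n (compl_of_gap (by omega) (by omega) hr') fun i hi _ =>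
      ⟨compl_of_gap (by omega) (by omega) (by omega), compl_of_gap (by omega) (by omega) (by omega)⟩
  rw [hn, show r - (r + 1) = -1 by ring] at step2
  exact rch_trans (rch_trans step1 step2) (rch_bottom J)

/-- **Every complement face is joined to the base face inside the complement.** [folklore] -/
theorem rch_compl {v : HexVertex} (hv : v ∈ (↑(Lam K N) : Set HexVertex)ᶜ) : (v, fj 0 (-1)) ∈ RchRel (↑(Lam K N) : Set HexVertex)ᶜ := by
  rw [← fj_jOf_rOf v] at hv ⊢
  generalize jOf v = j at hv ⊢
  generalize rOf v = r at hv ⊢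
  rcases lt_or_ge r 0 with hr | hr
  · exact rch_of_neg hr
  rw [fj_mem_compl_iff] at hv
  have h2K := @one_le_two_pow K
  rcases lt_or_ge (Ht K N) r with hhi | hhi
  · -- above the top row: everything to the right is free
    exact rch_of_rightFree hr fun i _ => compl_of_high hhi
  -- rows `0 … Ht`: locate the face
  by_cases hright : jD N + 2 ≤ j
  · exact rch_of_rightFree hr fun i hi => compl_of_right (hright.trans hi)
  by_cases hleft : j ≤ -(4 * N : ℤ) - 3
  · exact rch_of_leftFree hr fun i hi => compl_of_left (hi.trans hleft)
  -- remaining: the gap columns below the top row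
  have hgap : 2 * N + 3 ≤ j ∧ j ≤ 2 * N + 5 ∧ r < Ht K N := by
    unfold InLam InBox InTop InDown jD at hv; unfold jD at hright; omega
  exact rch_of_gap hr hgap.2.2 hgap.1 hgap.2.1

/-- **The forcing domain is simply connected** (connected complement). [folklore] -/
theorem simplyConnected_Lam : hexDomainSimplyConnected (Lam K N) := by
  intro u v
  obtain ⟨hu, h0, p⟩ := rch_compl u.2
  obtain ⟨hv, h0', q⟩ := rch_compl v.2
  exact p.trans q.symm

end Forcing

section Instance

variable {K N : ℕ}

/-! ### The instance data of `RootRenewal` on the forcing domain -/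

/-- The source face `w` (row `1`, the centre of the exact half-ball patch). [folklore] -/
def wF : HexVertex := fj 0 1
/-- The other endpoint of the source mid-edge. [folklore] -/
def uF : HexVertex := fj 1 1
/-- The target face (foot of the down column, row `0`). [folklore] -/
def yF (N : ℕ) : HexVertex := fj (jD N) 0
/-- The outer endpoint of the target mid-edge (row `-1`, outside the domain). [folklore] -/
def yF' (N : ℕ) : HexVertex := fj (jD N + 1) (-1)
/-- The target mid-edge. [folklore] -/
def zF (N : ℕ) : Sym2 HexVertex := s(yF N, yF' N)

/-- The down-column index is even. [folklore] -/
theorem jD_even : jD N % 2 = 0 := by unfold jD; omega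

/-- The source mid-edge is a lattice edge. [folklore] -/
theorem adj_uF_wF : hexGraph.Adj uF wF := by
  have := (adj_fj_succ 0 1).symm
  simpa [uF, wF] using this

/-- The target mid-edge is a lattice edge. [folklore] -/
theorem adj_yF_yF' : hexGraph.Adj (yF N) (yF' N) := by
  have := adj_fj_down (jD_even (N := N)) 0
  rwa [zero_sub] at this

/-- The source face lies in `Λ`. [folklore] -/
theorem wF_mem : wF ∈ Lam K N := by
  have := @one_le_two_pow K
  unfold wF; rw [fj_mem_Lam_iff]; left; unfold InBox Ht; omega

/-- The foot of the down column lies in `Λ`. [folklore] -/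
theorem yF_mem : yF N ∈ Lam K N := by
  have := @one_le_two_pow K
  unfold yF; rw [fj_mem_Lam_iff]; right; right; unfold InDown Ht; omega

/-- The outer face of the target mid-edge is outside `Λ`. [folklore] -/
theorem yF'_not_mem : yF' N ∉ Lam K N := by
  unfold yF'; rw [fj_mem_Lam_iff]; exact fun h => absurd (row_nonneg_of_InLam h) (by norm_num)

/-- `u` is not in the down column. [folklore] -/
theorem uF_not_InDown : ¬ InDown K N 1 1 := by unfold InDown jD; omega
/-- `w` is not in the down column. [folklore] -/
theorem wF_not_InDown : ¬ InDown K N 0 1 := by unfold InDown jD; omega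

/-- Row of a coordinate face. [folklore] -/
theorem row_fj (j r : ℤ) : row (fj j r) = r := by unfold row; exact fj_fst_one j r

/-- The source face has row `0 + 1`. [folklore] -/
theorem row_wF : row wF = (0 : ℤ) + ((1 : ℕ) : ℤ) := by unfold wF; rw [row_fj]; norm_num

/-- `w ≠` foot. [folklore] -/
theorem wF_ne_yF : wF ≠ yF N := by
  unfold wF yF; intro h; have := (fj_inj.1 h).2; omega

/-- `w ≠` outer target face. [folklore] -/
theorem wF_ne_yF' : wF ≠ yF' N := by
  unfold wF yF'; intro h; have := (fj_inj.1 h).2; omega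

/-- `w` is not on the target mid-edge. [folklore] -/
theorem wF_not_mem_zF : wF ∉ zF N := by
  unfold zF; intro h
  rcases Sym2.mem_iff.1 h with h | h
  · exact wF_ne_yF h
  · exact wF_ne_yF' h

/-- Source and target mid-edges differ. [folklore] -/
theorem a_ne_zF : s(uF, wF) ≠ zF N := fun h => wF_not_mem_zF (h ▸ Sym2.mem_mk_right uF wF)

/-- The target is a mid-edge of the domain. [folklore] -/
theorem zF_mem_midEdges : zF N ∈ hexDomainMidEdges (Lam K N) :=
  ⟨(SimpleGraph.mem_edgeSet hexGraph).2 adj_yF_yF', yF N, Sym2.mem_mk_left _ _, yF_mem⟩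

/-- The source is a mid-edge of the domain. [folklore] -/
theorem a_mem_midEdges : s(uF, wF) ∈ hexDomainMidEdges (Lam K N) :=
  ⟨(SimpleGraph.mem_edgeSet hexGraph).2 adj_uF_wF, wF, Sym2.mem_mk_right _ _, wF_mem⟩

/-! ### Metric facts: the patch clause and the far clause -/

/-- Abscissa of the source face. [folklore] -/
theorem re_wF : (hexCenter wF).re = 1 := by
  unfold wF; rw [re_hexCenter_fj]; norm_num

/-- Height bound of the source face. [folklore] -/
theorem im_wF_le : (hexCenter wF).im ≤ (5 / 3) * (Real.sqrt 3 / 2) := by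
  have := (im_hexCenter_fj_bounds 0 1).2
  unfold wF; push_cast at this; linarith

/-- **The patch clause**: inside the ball of radius `R₀ ≤ N` about `w`, the forcing domain is
exactly the half-lattice of nonnegative rows. [folklore] -/
theorem patch_clause {R₀ : ℝ} (hRN : R₀ ≤ N) (v : HexVertex)
    (hv : dist (hexCenter v) (hexCenter wF) ≤ R₀) : v ∈ Lam K N ↔ 0 ≤ row v := by
  rw [← fj_jOf_rOf v] at hv ⊢
  generalize jOf v = j at hv ⊢
  generalize rOf v = r at hv ⊢
  rw [row_fj, fj_mem_Lam_iff]
  refine ⟨row_nonneg_of_InLam, fun hr => Or.inl ?_⟩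
  have h2K := @one_le_two_pow K
  rw [dist_eq_norm] at hv
  have hre := (Complex.abs_re_le_norm (hexCenter (fj j r) - hexCenter wF)).trans hv
  have him := (Complex.abs_im_le_norm (hexCenter (fj j r) - hexCenter wF)).trans hv
  rw [Complex.sub_re, re_hexCenter_fj, re_wF] at hre
  rw [Complex.sub_im] at him
  have him' : (hexCenter (fj j r)).im - (hexCenter wF).im ≤ N := (le_abs_self _).trans (him.trans hRN)
  have hlo := (im_hexCenter_fj_bounds j r).1
  have hw := im_wF_le
  obtain ⟨h3, h17, -⟩ := sqrt_three_bounds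
  have hre' : |((j : ℝ) + r + 1) / 2 - 1| ≤ N := hre.trans hRN
  rw [abs_le] at hre'
  obtain ⟨hre1, hre2⟩ := hre'
  -- row bound: r ≤ 2N + 3
  have hrow : r ≤ 2 * N + 3 := by
    by_contra hc
    push Not at hc
    have hc' : (2 * N + 4 : ℝ) ≤ r := by exact_mod_cast hc
    nlinarith
  have hj1 : -(4 * N : ℤ) - 2 ≤ j := by
    have : (-(2 * N : ℝ)) + 1 ≤ j + r := by linarith
    have : -(2 * (N : ℤ)) + 1 ≤ j + r := by exact_mod_cast this
    omega
  have hj2 : j ≤ 2 * N + 2 := by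
    have : (j : ℝ) + r ≤ 2 * N + 1 := by linarith
    have : j + r ≤ 2 * (N : ℤ) + 1 := by exact_mod_cast this
    omega
  unfold InBox Ht
  omega

/-- **The far clause**: both endpoints of the target mid-edge are at distance `≥ N ≥ R₀` from `w`. [folklore] -/
theorem far_clause {R₀ : ℝ} (hRN : R₀ ≤ N) (v : HexVertex) (hv : v ∈ zF N) :
    R₀ ≤ dist (hexCenter v) (hexCenter wF) := by
  have key : ∀ j r : ℤ, j + r = jD N → R₀ ≤ dist (hexCenter (fj j r)) (hexCenter wF) := by
    intro j r hjr
    rw [dist_eq_norm]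
    refine le_trans ?_ (Complex.abs_re_le_norm _)
    rw [Complex.sub_re, re_hexCenter_fj, re_wF]
    have : ((j : ℝ) + r) = jD N := by exact_mod_cast hjr
    unfold jD at this; push_cast at this
    rw [abs_of_nonneg (by linarith)]
    linarith
  unfold zF yF yF' at hv
  rcases Sym2.mem_iff.1 hv with rfl | rfl
  · exact key _ _ (by ring)
  · exact key _ _ (by ring)

end Instance

end RootRenewalDefects

end Summit.CriticalPhenomena.SAWScalingLimit.Theorems.ObservableToSLER.Negative
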